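import Summits.NavierStokesRegularity.NavierStokesRegularity.Theses.RellichScar
import Summits.NavierStokesRegularity.NavierStokesRegularity.Theorems.ScarRigidity.Negative.LogicAndLoadBearing
import Literature.Analysis.FluidPDE.TypeIAncientMild
import Literature.Analysis.FluidPDE.ParasiticSlabFlow
import Summits.NavierStokesRegularity.NavierStokesRegularity.Theorems.RellichScarScarRigidityApexMild
import Summits.NavierStokesRegularity.NavierStokesRegularity.Theorems.RellichScarScarRigidityApexBoundsFull
import Summits.NavierStokesRegularity.NavierStokesRegularity.Theorems.RellichScarScarRigidityFarField
import Summits.NavierStokesRegularity.NavierStokesRegularity.Theorems.RellichScarScarRigidityTwinNorms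
import Summits.NavierStokesRegularity.NavierStokesRegularity.Theorems.RellichScarScarRigidityLogConvexityODE
import Summits.NavierStokesRegularity.NavierStokesRegularity.Theorems.RellichScarScarRigidityLogConvexityExtinction
import HarnessLib

/-!
# `ScarRigidity` — line `finite-energy-log-convexity` (crux stmt-NavierStokesRegularity-11717, route RellichScar)

SKELETON of the line lead (prover-line-stmt-NavierStokesRegularity-11717-0), RESHAPED from the planner's
checked skeleton (3 stubs `stub_scarTwinFiniteEnergy` / `stub_logConvexityBelowThreshold` /
`stub_noAnomalousExtinction`, registered 2026-08-15T23:51Z) into six stubs whose composition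
`ScarRigidity_of` proves `RellichScar.ScarRigidity` BY NAME:

* `stub_apexMildRepresentative` (S1α, single profile, PDE; LANDED p73895): an apex-class suitable weak solution
  (`𝐈 < ∞`, `‖u‖ ≤ C/(‖x‖+√−t)`) has a representative `V` which is a Type-I ancient MILD solution in the
  Oseen/KNSS gauge (`IsTypeIAncientMild C V`: jointly `C^∞` on the open slab, divergence free, Duhamel formula
  between all pairs of times) with the same apex bound — bounded (on `t ≤ −δ`) weak solutions are mild modulo
  a drift (KNSS 2009 §4), and the spatial decay kills the drift.
* `stub_apexDerivativeBoundsWithGauge` (S1β, single profile, PDE; LANDED p87236): a Type-I ancient mild field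
  with the apex bound is a CLASSICAL solution with a jointly smooth pressure `Q` and obeys the scale-invariant
  bounds `|∇V| ≲ (‖x‖+√−t)⁻²`, `|∇²V|, |∂ₜV|, |∇Q| ≲ (‖x‖+√−t)⁻³`, `|Q − a(t)| ≲ (‖x‖+√−t)⁻²` (gauge `a`) (KNSS smoothing at the
  parabolic scale + ε-regularity at scale `‖x‖`; the pressure by Calderón–Zygmund off the diagonal).
* `stub_farFieldOfScar` (S1b, twin, elementary; LANDED p91784): same scar + `|∂ₜVᵢ| ≲ ‖x‖⁻³` ⇒
  `‖V₁ − V₂‖ ≤ (L₁+L₂)(−t)/‖x‖³` for every `t < 0`, `x ≠ 0` (fundamental theorem of calculus from the final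
  slice, where the continuous representatives agree).
* `stub_twinNorms` (S2, twin, measure theory; LANDED p94282): apex bound + far-field bound ⇒ the single majorant
  `‖V₁−V₂‖ ≤ K'(−t)/(‖x‖+√−t)³` and, by scaling `x = √(−t)·y`, the rates `‖w(t)‖₂ ≲ |t|^{1/4}`,
  `‖w(t)‖_{6/5} ≲ |t|^{3/4}`, `‖∇w(t)‖₂ ≲ |t|^{−1/4}` ("finite energy is what the scar buys").
* `stub_coulombEnergyPackage` (S4-E, twin, potential theory; OPEN formalization, wave 3): the Coulomb
  (`Ḣ⁻¹`) energy `N(t)` and `L²` energy `b(t)` of `w = V₁ − V₂` with the Agmon–Nirenberg energy inequality,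
  the frequency law at constant `C`, `N(t) → 0` (`t ↑ 0`) and `N = 0 ⇒ w = 0`.
* `stub_logConvexityBelowThreshold` (S4, twin; now PROVED from S4-E + landed helpers p93251, p94500, p93507,
  p93368, p94777, p93861): Agmon–Nirenberg log-convexity in `Ḣ⁻¹_σ`
  (pressure-free: `‖ℙ∇·(w⊗V₁+V₂⊗w)‖_{Ḣ⁻¹} ≤ (2C/√|t|)‖w‖₂`, Riccati law `Λ̇ ≤ 2C²Λ/|t|`, so `|t|^{2C²}Λ`
  is monotone and `log ‖w‖²_{Ḣ⁻¹}` stays bounded below iff `2C² < 1`) against `‖w(t)‖_{Ḣ⁻¹} ≲ |t|^{3/4} → 0`: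
  the twins coincide when `2C² < 1`. No singularity hypothesis is used.
* `stub_noAnomalousExtinction` (S5, OPEN — the residual, held by the lead): the crux on `1 ≤ 2C²`
  (`ScarRigidityAt C`), where the abstract log-convexity frame admits extinction (Miller 1974) and a
  Navier–Stokes-specific lever acting on the parabolic core is required (TRIAGE r1-1 O3, r1-2, r1-3).

Composition: `scarRigidity_iff_pos` (Negative/LogicAndLoadBearing: only `0 < C` carries content) and a case
split on `2C² < 1`.  Disproof honoured: every stub keeps the equations, the WHOLE slab and the spatial apex
decay ((A⁺)(B⁺)(B)(C)(C″)(D) of `Cruxes/ScarRigidity/Disproof.lean`); nothing is exterior or local.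
-/

noncomputable section

open Set Filter Function MeasureTheory Metric TopologicalSpace
open scoped Topology ENNReal NNReal InnerProductSpace RealInnerProductSpace
open Literature.Analysis.FluidPDE
open Summit.NavierStokesRegularity.NavierStokesRegularity.Theses.RellichScar
open Summit.NavierStokesRegularity.NavierStokesRegularity.Theorems.ScarRigidity.Negative

set_option linter.dupNamespace false

namespace Summit.NavierStokesRegularity.NavierStokesRegularity.Theorems.RellichScarScarRigidity

/-- Physical space. -/
local notation "ℝ³" => EuclideanSpace ℝ (Fin 3)

/-- The open backward slab `(-∞,0) × ℝ³` (time first), as in the route file. -/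
local notation "𝕊" => Literature.Analysis.FluidPDE.slab (EuclideanSpace ℝ (Fin 3)) (Set.Iio (0 : ℝ)) isOpen_Iio

/-! ## The stubs -/

-- S1α `stub_apexMildRepresentative`: LANDED (p73895, Theorems/RellichScarScarRigidityApexMild.lean), imported.

-- S1β `stub_apexDerivativeBounds`: RESHAPED to the gauge form `stub_apexDerivativeBoundsWithGauge`
-- (pressure bound `|Q t x - a t| ≤ L/ρ²` with a free gauge `a : ℝ → ℝ`; the Leray gauge `a = 0` would need
-- spatial decay of all `∂ₜᵏV` for joint smoothness) and LANDED (p87236, Theorems/RellichScarScarRigidityApexBoundsFull.lean), imported.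

-- S1b `stub_farFieldOfScar`: LANDED (p91784, Theorems/RellichScarScarRigidityFarField.lean), imported.

-- S2 `stub_twinNorms`: LANDED (p94282, Theorems/RellichScarScarRigidityTwinNorms.lean), imported.

/-- **S4-E `stub_coulombEnergyPackage` — the Coulomb (`Ḣ⁻¹`) energy package of the twin difference
(the one remaining ANALYTIC input of S4; true, formalization in progress — wave 3).** For two classical
apex profiles with the S1β bounds and the S2 package, the difference `w = V₁ - V₂` carries real
functions `N, b ≥ 0` (the Coulomb energy `‖w(t)‖²_{Ḣ⁻¹}` and `‖w(t)‖²_{L²}`), differentiable on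
`t < 0`, with the Agmon–Nirenberg energy inequality and frequency law at constant `C`,
`N(t) → 0` as `t ↑ 0`, and `N(t) = 0 ⇒ w(t) = 0` (module docstring). Potential theory of the
Newtonian kernel on `ℝ³` for smooth divergence-free densities with `|w| ≲ ρ⁻³`, `|∇w| ≲ ρ⁻²`
(`ρ = ‖x‖ + √(-t)`): `ψ = (-Δ)⁻¹w ∈ C²`, `div ψ = 0`, `‖∇ψ‖₂² = ⟪w, ψ⟫`, differentiation of the
Coulomb energy in time, whole-space integrations by parts, and `N ≲ (-t)^{3/2}`. [folklore] -/
theorem stub_coulombEnergyPackage :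
    ∀ (V₁ V₂ : ℝ → ℝ³ → ℝ³) (Q₁ Q₂ : ℝ → ℝ³ → ℝ) (a₁ a₂ : ℝ → ℝ) (C L₁ L₂ K' : ℝ), 0 < C →
      IsClassicalNSSolutionOn (Iio (0 : ℝ)) 1 0 V₁ Q₁ → IsClassicalNSSolutionOn (Iio (0 : ℝ)) 1 0 V₂ Q₂ →
      HasTypeIDecay C V₁ → HasTypeIDecay C V₂ →
      (∀ t < 0, ∀ x : ℝ³, ‖fderiv ℝ (V₁ t) x‖ ≤ L₁ / (‖x‖ + Real.sqrt (-t)) ^ 2) →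
      (∀ t < 0, ∀ x : ℝ³, ‖iteratedFDeriv ℝ 2 (V₁ t) x‖ ≤ L₁ / (‖x‖ + Real.sqrt (-t)) ^ 3) →
      (∀ t < 0, ∀ x : ℝ³, ‖deriv (fun s => V₁ s x) t‖ ≤ L₁ / (‖x‖ + Real.sqrt (-t)) ^ 3) →
      (∀ t < 0, ∀ x : ℝ³, |Q₁ t x - a₁ t| ≤ L₁ / (‖x‖ + Real.sqrt (-t)) ^ 2) →
      (∀ t < 0, ∀ x : ℝ³, ‖gradient (Q₁ t) x‖ ≤ L₁ / (‖x‖ + Real.sqrt (-t)) ^ 3) →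
      (∀ t < 0, ∀ x : ℝ³, ‖fderiv ℝ (V₂ t) x‖ ≤ L₂ / (‖x‖ + Real.sqrt (-t)) ^ 2) →
      (∀ t < 0, ∀ x : ℝ³, ‖iteratedFDeriv ℝ 2 (V₂ t) x‖ ≤ L₂ / (‖x‖ + Real.sqrt (-t)) ^ 3) →
      (∀ t < 0, ∀ x : ℝ³, ‖deriv (fun s => V₂ s x) t‖ ≤ L₂ / (‖x‖ + Real.sqrt (-t)) ^ 3) →
      (∀ t < 0, ∀ x : ℝ³, |Q₂ t x - a₂ t| ≤ L₂ / (‖x‖ + Real.sqrt (-t)) ^ 2) →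
      (∀ t < 0, ∀ x : ℝ³, ‖gradient (Q₂ t) x‖ ≤ L₂ / (‖x‖ + Real.sqrt (-t)) ^ 3) →
      (∀ t < 0,
        (∀ x : ℝ³, ‖V₁ t x - V₂ t x‖ ≤ K' * (-t) / (‖x‖ + Real.sqrt (-t)) ^ 3) ∧
        eLpNorm (fun x => V₁ t x - V₂ t x) 2 volume ≤ ENNReal.ofReal (K' * (-t) ^ ((1 : ℝ) / 4)) ∧
        eLpNorm (fun x => V₁ t x - V₂ t x) ((6 : ℝ≥0∞) / 5) volume ≤
          ENNReal.ofReal (K' * (-t) ^ ((3 : ℝ) / 4)) ∧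
        eLpNorm (fun x => fderiv ℝ (V₁ t) x - fderiv ℝ (V₂ t) x) 2 volume ≤
          ENNReal.ofReal (K' * (-t) ^ (-(1 : ℝ) / 4))) →
      ∃ N b N' b' : ℝ → ℝ,
        (∀ t < 0, HasDerivAt N (N' t) t) ∧ (∀ t < 0, HasDerivAt b (b' t) t) ∧
        (∀ t < 0, 0 ≤ N t) ∧ (∀ t < 0, 0 ≤ b t) ∧
        (∀ t < 0, -(2 * b t + 4 * C / Real.sqrt (-t) * Real.sqrt (b t * N t)) ≤ N' t) ∧
        (∀ t < 0, b' t * N t - b t * N' t ≤ 2 * C ^ 2 / (-t) * (b t * N t)) ∧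
        Tendsto N (𝓝[<] 0) (𝓝 0) ∧
        (∀ t < 0, N t = 0 → ∀ x : ℝ³, V₁ t x = V₂ t x) := by
  sorry

/-- **S4 — log-convexity below the threshold `2C² < 1` (the line's theorem; no singularity hypothesis)**,
ASSEMBLED from `stub_coulombEnergyPackage` and the landed real-variable core `eq_of_energyPackage`
(Theorems/RellichScarScarRigidityLogConvexity{ODE,Extinction}.lean, p93251/p94500).
Two classical Navier–Stokes solutions on the open slab with the apex bound at constant `C`, the
scale-invariant derivative/pressure bounds of S1β (pressure modulo a time-dependent gauge `aᵢ(t)`, which is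
invisible to the projected equation) and the twin smallness/finite-energy package of S2
coincide when `2C² < 1`: in `H = Ḣ⁻¹_σ(ℝ³)` with `A` the Stokes operator, `w = V₁ − V₂` solves
`ẇ + Aw = −ℙ∇·(w⊗V₁ + V₂⊗w)` with `‖ℙ∇·(w⊗V₁+V₂⊗w)‖_H ≤ (2C/√|t|)‖A^{1/2}w‖_H`; the frequency
`Λ = ‖A^{1/2}w‖²/‖w‖²` obeys `Λ̇ ≤ 2C²Λ/|t|`, so `Λ ≤ M|t|^{−2C²}` and
`d/dt log ‖w‖²_H ≥ −2Λ − (4C/√|t|)Λ^{1/2}` is integrable up to `t = 0` iff `2C² < 1`; hence `w(t₀) ≠ 0`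
forces `inf ‖w(t)‖_H > 0`, contradicting `‖w(t)‖_{Ḣ⁻¹} ≲ ‖w(t)‖_{L^{6/5}} ≤ K'|t|^{3/4} → 0`.
Sources: Agmon–Nirenberg 1967 / Ogawa 1965 (log-convexity), Miller 1974 (sharpness of thresholds in the
abstract frame), TRIAGE r1-1 O1–O2, r1-3. -/
theorem stub_logConvexityBelowThreshold :
    ∀ (V₁ V₂ : ℝ → ℝ³ → ℝ³) (Q₁ Q₂ : ℝ → ℝ³ → ℝ) (a₁ a₂ : ℝ → ℝ) (C L₁ L₂ K' : ℝ), 0 < C → 2 * C ^ 2 < 1 →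
      IsClassicalNSSolutionOn (Iio (0 : ℝ)) 1 0 V₁ Q₁ → IsClassicalNSSolutionOn (Iio (0 : ℝ)) 1 0 V₂ Q₂ →
      HasTypeIDecay C V₁ → HasTypeIDecay C V₂ →
      (∀ t < 0, ∀ x : ℝ³, ‖fderiv ℝ (V₁ t) x‖ ≤ L₁ / (‖x‖ + Real.sqrt (-t)) ^ 2) →
      (∀ t < 0, ∀ x : ℝ³, ‖iteratedFDeriv ℝ 2 (V₁ t) x‖ ≤ L₁ / (‖x‖ + Real.sqrt (-t)) ^ 3) →
      (∀ t < 0, ∀ x : ℝ³, ‖deriv (fun s => V₁ s x) t‖ ≤ L₁ / (‖x‖ + Real.sqrt (-t)) ^ 3) →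
      (∀ t < 0, ∀ x : ℝ³, |Q₁ t x - a₁ t| ≤ L₁ / (‖x‖ + Real.sqrt (-t)) ^ 2) →
      (∀ t < 0, ∀ x : ℝ³, ‖gradient (Q₁ t) x‖ ≤ L₁ / (‖x‖ + Real.sqrt (-t)) ^ 3) →
      (∀ t < 0, ∀ x : ℝ³, ‖fderiv ℝ (V₂ t) x‖ ≤ L₂ / (‖x‖ + Real.sqrt (-t)) ^ 2) →
      (∀ t < 0, ∀ x : ℝ³, ‖iteratedFDeriv ℝ 2 (V₂ t) x‖ ≤ L₂ / (‖x‖ + Real.sqrt (-t)) ^ 3) →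
      (∀ t < 0, ∀ x : ℝ³, ‖deriv (fun s => V₂ s x) t‖ ≤ L₂ / (‖x‖ + Real.sqrt (-t)) ^ 3) →
      (∀ t < 0, ∀ x : ℝ³, |Q₂ t x - a₂ t| ≤ L₂ / (‖x‖ + Real.sqrt (-t)) ^ 2) →
      (∀ t < 0, ∀ x : ℝ³, ‖gradient (Q₂ t) x‖ ≤ L₂ / (‖x‖ + Real.sqrt (-t)) ^ 3) →
      (∀ t < 0,
        (∀ x : ℝ³, ‖V₁ t x - V₂ t x‖ ≤ K' * (-t) / (‖x‖ + Real.sqrt (-t)) ^ 3) ∧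
        eLpNorm (fun x => V₁ t x - V₂ t x) 2 volume ≤ ENNReal.ofReal (K' * (-t) ^ ((1 : ℝ) / 4)) ∧
        eLpNorm (fun x => V₁ t x - V₂ t x) ((6 : ℝ≥0∞) / 5) volume ≤
          ENNReal.ofReal (K' * (-t) ^ ((3 : ℝ) / 4)) ∧
        eLpNorm (fun x => fderiv ℝ (V₁ t) x - fderiv ℝ (V₂ t) x) 2 volume ≤
          ENNReal.ofReal (K' * (-t) ^ (-(1 : ℝ) / 4))) →
      ∀ t < 0, ∀ x : ℝ³, V₁ t x = V₂ t x := by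
  intro V₁ V₂ Q₁ Q₂ a₁ a₂ C L₁ L₂ K' hC hthr hcl₁ hcl₂ hd₁ hd₂ hg₁ hh₁ ht₁ hq₁ hgq₁ hg₂ hh₂ ht₂ hq₂
    hgq₂ hK'
  obtain ⟨N, b, N', b', hN, hb, hN0, hb0, hlog, hfreq, hvan, hker⟩ :=
    stub_coulombEnergyPackage V₁ V₂ Q₁ Q₂ a₁ a₂ C L₁ L₂ K' hC hcl₁ hcl₂ hd₁ hd₂ hg₁ hh₁ ht₁ hq₁
      hgq₁ hg₂ hh₂ ht₂ hq₂ hgq₂ hK'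
  exact eq_of_energyPackage hC hthr hN hb hN0 hb0 hlog hfreq hvan hker

/-- **S5 — NO ANOMALOUS EXTINCTION (the OPEN residual of the line = the crux on `1 ≤ 2C²`).**
Above the threshold the abstract log-convexity frame `ẇ + Aw = B(t)w`, `‖B(t)‖_{D(A^{1/2})→H} ≤ 2C|t|^{−1/2}`
admits extinction at `t = 0` (Miller 1974), so a Navier–Stokes-specific lever acting on the parabolic core at
arbitrary Type-I constant is required; none is known (TRIAGE r1-1 O3, r1-2 bottom line, r1-3 S4).  By S1α–S4
the finite-energy ticket (`‖w(t)‖_{Ḣ⁻¹} ≲ |t|^{3/4}`, `w(t) ∈ L² ∩ Ḣ¹`) is pre-paid for any attack. -/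
theorem stub_noAnomalousExtinction : ∀ C : ℝ, 1 ≤ 2 * C ^ 2 → ScarRigidityAt C := by
  sorry

/-! ## Composition -/

/-- A pointwise statement on `t < 0` holds a.e. on the slab `Iio 0 ×ˢ univ`. [folklore] -/
theorem ae_slab_of_forall {P : ℝ × ℝ³ → Prop} (h : ∀ t < 0, ∀ x : ℝ³, P (t, x)) :
    ∀ᵐ z ∂(volume.restrict (Iio (0 : ℝ) ×ˢ (univ : Set ℝ³))), P z := by
  filter_upwards [ae_restrict_mem (measurableSet_Iio.prod MeasurableSet.univ)] with z hz
  exact h z.1 (mem_prod.1 hz).1 z.2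

/-- **The line closes the crux modulo its stubs**: `ScarRigidity` from S1α, S1β, S1b, S2, S4 (the
threshold theorem on `2C² < 1`) and the residual S5 (`1 ≤ 2C²`), via the normal form
`scarRigidity_iff_pos` (only `0 < C` carries content). -/
theorem ScarRigidity_of : ScarRigidity := by
  rw [scarRigidity_iff_pos]
  intro C hC
  by_cases hthr : 2 * C ^ 2 < 1
  · intro u₁ p₁ G₁ u₂ p₂ G₂ hs₁ hg₁ hI₁ hd₁ hs₂ hg₂ hI₂ hd₂ _ _ hscar
    obtain ⟨V₁, hae₁, hm₁, hdV₁⟩ := stub_apexMildRepresentative u₁ p₁ G₁ C hC hs₁ hg₁ hI₁ hd₁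
    obtain ⟨V₂, hae₂, hm₂, hdV₂⟩ := stub_apexMildRepresentative u₂ p₂ G₂ C hC hs₂ hg₂ hI₂ hd₂
    obtain ⟨Q₁, a₁, L₁, -, hcl₁, hg₁', hh₁, ht₁, hq₁, hgq₁⟩ :=
      stub_apexDerivativeBoundsWithGauge V₁ C hC hm₁ hdV₁
    obtain ⟨Q₂, a₂, L₂, -, hcl₂, hg₂', hh₂, ht₂, hq₂, hgq₂⟩ :=
      stub_apexDerivativeBoundsWithGauge V₂ C hC hm₂ hdV₂
    have hfar := stub_farFieldOfScar u₁ u₂ V₁ V₂ L₁ L₂ hcl₁.smooth_velocity hcl₂.smooth_velocity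
      hae₁ hae₂ ht₁ ht₂ hscar
    obtain ⟨K', _, hK'⟩ := stub_twinNorms V₁ V₂ C L₁ L₂ (L₁ + L₂) hdV₁ hdV₂ hg₁' hg₂' hfar
    have heq := stub_logConvexityBelowThreshold V₁ V₂ Q₁ Q₂ a₁ a₂ C L₁ L₂ K' hC hthr hcl₁ hcl₂ hdV₁ hdV₂
      hg₁' hh₁ ht₁ hq₁ hgq₁ hg₂' hh₂ ht₂ hq₂ hgq₂ hK'
    -- `u₁ = V₁ = V₂ = u₂` a.e. on the slab
    have hV : uncurry V₁ =ᵐ[volume.restrict (Iio (0 : ℝ) ×ˢ (univ : Set ℝ³))] uncurry V₂ :=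
      ae_slab_of_forall (P := fun z => uncurry V₁ z = uncurry V₂ z) fun t ht x => heq t ht x
    exact (hae₁.symm.trans hV).trans hae₂
  · exact stub_noAnomalousExtinction C (not_lt.1 hthr)

/-- The crux, by name (gate shape `theorem … : <route decl>`). -/
theorem scarRigidity_proof : ScarRigidity := ScarRigidity_of

end Summit.NavierStokesRegularity.NavierStokesRegularity.Theorems.RellichScarScarRigidity

end
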